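import Summits.Ventures.PackingBounds.Configurations.E8Moments
import Summits.Ventures.PackingBounds.Energy.UniversalOptimalityCrossPolytope

/-!
# Design identities of strengths 1, 2, 3 from vanishing total Gegenbauer moments

Framing: lottery ticket; floor = certified bounds/negative ranges. Venture `PackingBounds` (cell
`pub-packcert`, seat `pub-packcert-energy`) — infrastructure for the uniqueness of the sharp configurations
`(5, 16)`, `(6, 27)`, `(7, 56)`.

For a finite `C ⊂ S^{n-1}` (`n = 2μ + 2 ≥ 3`) whose TOTAL Gegenbauer moment `Σ_{x,y ∈ C} C_k^{(μ)}(⟪x,y⟫)`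
vanishes (complementary slackness gives this for LP-sharp codes), the moment vanishes about every unit vector
`u` of the space, in `C` or not (`extMoment_eq_zero_of_total`; bordered positive-semidefinite Gegenbauer
matrix, `E8Moments.crossSum_eq_zero_of_psd`). Polarising the cases `k = 1, 2, 3`:

* `sum_inner_eq_zero` (strength 1): `Σ_{w ∈ C} ⟪u, w⟫ = 0` for every `u`;
* `sum_inner_mul_inner` (strength 2): `Σ_{w ∈ C} ⟪u, w⟫ ⟪v, w⟫ = (|C| / n) ⟪u, v⟫` for all `u, v`;
* `sum_inner_mul_inner_mul_inner` (strength 3): `Σ_{w ∈ C} ⟪u, w⟫ ⟪v, w⟫ ⟪z, w⟫ = 0` for all `u, v, z`.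

## References
* P. Delsarte, J.-M. Goethals, J. J. Seidel, *Spherical codes and designs*, Geom. Dedicata 6 (1977) 363–388, §§4–5.
* H. Cohn, A. Kumar, J. Amer. Math. Soc. 20 (2007) 99–148, Appendix A. [`CohnKumar2006`]
-/

namespace Summit.Ventures.PackingBounds.Config.DesignIdentities

open Finset Literature.Analysis.SpecialFunctions Literature.Geometry.DiscreteGeometry

variable {n : ℕ} {μ : ℝ}

/-- **External moments from the total moment.** If `Σ_{x,y ∈ C} C_k^{(μ)}(⟪x,y⟫) = 0` for unit vectors
`C ⊂ ℝⁿ`, `n = 2μ + 2`, then `Σ_{y ∈ C} C_k^{(μ)}(⟪u,y⟫) = 0` for every unit vector `u`. -/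
theorem extMoment_eq_zero_of_total (hn : (n : ℝ) = 2 * μ + 2) (hμ : 0 < μ)
    (C : Finset (EuclideanSpace ℝ (Fin n))) (h1 : ∀ x ∈ C, ‖x‖ = 1) (k : ℕ)
    (htot : ∑ x ∈ C, ∑ y ∈ C, gegenbauerSum μ k (inner ℝ x y) = 0)
    {u : EuclideanSpace ℝ (Fin n)} (hu : ‖u‖ = 1) :
    ∑ y ∈ C, gegenbauerSum μ k (inner ℝ u y) = 0 := by
  classical
  set v : Option C → EuclideanSpace ℝ (Fin n) :=
    fun o => Option.elim o u fun a => (a : EuclideanSpace ℝ (Fin n)) with hv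
  have hM := E8Moments.crossSum_eq_zero_of_psd (ι := C)
    (fun a b => gegenbauerSum μ k (inner ℝ (v a) (v b)))
    (fun a b => by simp only [real_inner_comm]) ?_ ?_
  · have h' : ∑ b : C, gegenbauerSum μ k (inner ℝ u (b : EuclideanSpace ℝ (Fin n))) = 0 := by
      simpa only [hv, Option.elim] using hM
    rw [← Finset.sum_coe_sort C]
    exact h'
  · intro c
    have hpos := sum_mul_gegenbauerHom_nonneg (n := n) (μ := μ) hn hμ k
      (fun a : Option C => fun j => v a j) c
    have hunit : ∀ a : Option C, ∑ j, v a j ^ 2 = 1 := by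
      intro a
      rw [← EuclideanSpace.real_norm_sq_eq]
      cases a with
      | none => simp only [hv, Option.elim, hu, one_pow]
      | some a => simp only [hv, Option.elim, h1 a a.2, one_pow]
    have hinner : ∀ a b : Option C, inner ℝ (v a) (v b) = ∑ j, v a j * v b j := fun a b => by
      simp [PiLp.inner_apply, mul_comm]
    simp only [hunit, mul_one] at hpos
    simpa only [hinner, gegenbauerSum_eq_gegenbauerHom] using hpos
  · have h' : ∑ a : C, ∑ b : C, gegenbauerSum μ k
        (inner ℝ (a : EuclideanSpace ℝ (Fin n)) (b : EuclideanSpace ℝ (Fin n))) = 0 := by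
      rw [← Finset.sum_coe_sort C] at htot
      simp_rw [← Finset.sum_coe_sort C] at htot
      exact htot
    simpa only [hv, Option.elim] using h'

/-- **Strength 1.** If `Σ_{x,y ∈ C} C_1^{(μ)}(⟪x,y⟫) = 0` (`μ ≠ 0`) then `Σ_{w ∈ C} w = 0`, hence
`Σ_{w ∈ C} ⟪u, w⟫ = 0` for every vector `u`. -/
theorem sum_inner_eq_zero (hμ : μ ≠ 0) (C : Finset (EuclideanSpace ℝ (Fin n)))
    (htot : ∑ x ∈ C, ∑ y ∈ C, gegenbauerSum μ 1 (inner ℝ x y) = 0) (u : EuclideanSpace ℝ (Fin n)) :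
    ∑ w ∈ C, inner ℝ u w = 0 := by
  simp only [gegenbauerSum_one] at htot
  have h0 : ∑ x ∈ C, ∑ y ∈ C, inner ℝ x y = 0 := by
    have : ∑ x ∈ C, ∑ y ∈ C, 2 * μ * inner ℝ x y = 2 * μ * ∑ x ∈ C, ∑ y ∈ C, inner ℝ x y := by
      rw [Finset.mul_sum]
      exact Finset.sum_congr rfl fun x _ => by rw [Finset.mul_sum]
    rw [this] at htot
    rcases mul_eq_zero.mp htot with h | h
    · exact absurd h (mul_ne_zero two_ne_zero hμ)
    · exact h
  have hs : ∑ w ∈ C, w = 0 := by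
    have : inner ℝ (∑ x ∈ C, x) (∑ y ∈ C, y) = 0 := by
      rw [sum_inner]
      simp_rw [inner_sum]
      exact h0
    exact inner_self_eq_zero.mp this
  rw [← inner_sum, hs, inner_zero_right]

/-- **Strength 2.** If `Σ_{x,y ∈ C} C_2^{(μ)}(⟪x,y⟫) = 0` for unit vectors `C ⊂ ℝⁿ` (`n = 2μ + 2`, `μ > 0`),
then `Σ_{w ∈ C} ⟪u, w⟫ ⟪v, w⟫ = (|C|/n) ⟪u, v⟫` for all `u, v`. -/
theorem sum_inner_mul_inner (hn : (n : ℝ) = 2 * μ + 2) (hμ : 0 < μ)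
    (C : Finset (EuclideanSpace ℝ (Fin n))) (h1 : ∀ x ∈ C, ‖x‖ = 1)
    (htot : ∑ x ∈ C, ∑ y ∈ C, gegenbauerSum μ 2 (inner ℝ x y) = 0)
    (u v : EuclideanSpace ℝ (Fin n)) :
    ∑ w ∈ C, inner ℝ u w * inner ℝ v w = (C.card : ℝ) / n * inner ℝ u v := by
  have hn0 : (n : ℝ) ≠ 0 := by rw [hn]; positivity
  -- unit vectors
  have hunit : ∀ u : EuclideanSpace ℝ (Fin n), ‖u‖ = 1 →
      ∑ w ∈ C, inner ℝ u w ^ 2 = (C.card : ℝ) / n := by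
    intro u hu
    have h := extMoment_eq_zero_of_total hn hμ C h1 2 htot hu
    simp only [Energy.gegenbauerSum_two, Finset.sum_sub_distrib, ← Finset.mul_sum, Finset.sum_const,
      nsmul_eq_mul] at h
    rw [hn]
    field_simp
    nlinarith [h]
  -- homogeneous form
  have hhom : ∀ u : EuclideanSpace ℝ (Fin n), ∑ w ∈ C, inner ℝ u w ^ 2 = (C.card : ℝ) / n * ‖u‖ ^ 2 := by
    intro u
    by_cases hu : u = 0
    · subst hu; simp
    · have hnu : ‖u‖ ≠ 0 := norm_ne_zero_iff.mpr hu
      have hsc : ‖(‖u‖⁻¹ : ℝ) • u‖ = 1 := by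
        rw [norm_smul, norm_inv, norm_norm, inv_mul_cancel₀ hnu]
      have h := hunit _ hsc
      simp only [real_inner_smul_left, mul_pow, ← Finset.mul_sum] at h
      have hpos : 0 < ‖u‖ ^ 2 := by positivity
      field_simp at h
      field_simp
      linarith [h]
  -- polarisation
  have hp := hhom (u + v)
  have hm := hhom (u - v)
  simp only [inner_add_left, inner_sub_left] at hp hm
  have e1 : ‖u + v‖ ^ 2 = ‖u‖ ^ 2 + 2 * inner ℝ u v + ‖v‖ ^ 2 := norm_add_sq_real u v
  have e2 : ‖u - v‖ ^ 2 = ‖u‖ ^ 2 - 2 * inner ℝ u v + ‖v‖ ^ 2 := norm_sub_sq_real u v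
  rw [e1] at hp
  rw [e2] at hm
  have hdiff : ∑ w ∈ C, (inner ℝ u w + inner ℝ v w) ^ 2 - ∑ w ∈ C, (inner ℝ u w - inner ℝ v w) ^ 2 =
      4 * ∑ w ∈ C, inner ℝ u w * inner ℝ v w := by
    rw [← Finset.sum_sub_distrib, Finset.mul_sum]
    exact Finset.sum_congr rfl fun w _ => by ring
  linarith [hdiff]

/-- **Strength 3.** If the total moments of orders `1` and `3` vanish for unit vectors `C ⊂ ℝⁿ`
(`n = 2μ + 2`, `μ > 0`), then `Σ_{w ∈ C} ⟪u, w⟫ ⟪v, w⟫ ⟪z, w⟫ = 0` for all `u, v, z`. -/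
theorem sum_inner_mul_inner_mul_inner (hn : (n : ℝ) = 2 * μ + 2) (hμ : 0 < μ)
    (C : Finset (EuclideanSpace ℝ (Fin n))) (h1 : ∀ x ∈ C, ‖x‖ = 1)
    (htot1 : ∑ x ∈ C, ∑ y ∈ C, gegenbauerSum μ 1 (inner ℝ x y) = 0)
    (htot3 : ∑ x ∈ C, ∑ y ∈ C, gegenbauerSum μ 3 (inner ℝ x y) = 0)
    (u v z : EuclideanSpace ℝ (Fin n)) :
    ∑ w ∈ C, inner ℝ u w * inner ℝ v w * inner ℝ z w = 0 := by
  -- cubes vanish about unit vectors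
  have hcube1 : ∀ u : EuclideanSpace ℝ (Fin n), ‖u‖ = 1 → ∑ w ∈ C, inner ℝ u w ^ 3 = 0 := by
    intro u hu
    have h := extMoment_eq_zero_of_total hn hμ C h1 3 htot3 hu
    have hl := sum_inner_eq_zero hμ.ne' C htot1 u
    simp only [Energy.UniversalCrossPolytope.gegenbauerSum_three, Finset.sum_sub_distrib, ← Finset.mul_sum]
      at h
    rw [hl, mul_zero, sub_zero] at h
    have hc : (4 / 3 * μ * (μ + 1) * (μ + 2) : ℝ) ≠ 0 := by positivity
    exact (mul_eq_zero.mp h).resolve_left hc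
  -- homogeneous
  have hcube : ∀ u : EuclideanSpace ℝ (Fin n), ∑ w ∈ C, inner ℝ u w ^ 3 = 0 := by
    intro u
    by_cases hu : u = 0
    · subst hu; simp
    · have hnu : ‖u‖ ≠ 0 := norm_ne_zero_iff.mpr hu
      have hsc : ‖(‖u‖⁻¹ : ℝ) • u‖ = 1 := by
        rw [norm_smul, norm_inv, norm_norm, inv_mul_cancel₀ hnu]
      have h := hcube1 _ hsc
      simp only [real_inner_smul_left, mul_pow, ← Finset.mul_sum] at h
      have hne : (‖u‖⁻¹ : ℝ) ^ 3 ≠ 0 := pow_ne_zero 3 (inv_ne_zero hnu)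
      exact (mul_eq_zero.mp h).resolve_left hne
  -- polarisation of the cubic form
  have key : ∀ w : EuclideanSpace ℝ (Fin n), inner ℝ u w * inner ℝ v w * inner ℝ z w =
      (1 / 6 : ℝ) * (inner ℝ (u + v + z) w ^ 3 - inner ℝ (u + v) w ^ 3 - inner ℝ (u + z) w ^ 3
        - inner ℝ (v + z) w ^ 3 + inner ℝ u w ^ 3 + inner ℝ v w ^ 3 + inner ℝ z w ^ 3) := by
    intro w
    simp only [inner_add_left]
    ring
  rw [Finset.sum_congr rfl fun w _ => key w, ← Finset.mul_sum]
  simp only [Finset.sum_add_distrib, Finset.sum_sub_distrib, hcube]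
  norm_num

end Summit.Ventures.PackingBounds.Config.DesignIdentities
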